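import Literature.Analysis.FluidPDE.TaoY6WhitneyMass
import Literature.Analysis.FluidPDE.TaoWhitneyKernel
import HarnessLib

/-!
# The Whitney-scale mass bound in the annulus

Analysis/FluidPDE support file for the discharge of the named fact
`Literature.Analysis.FluidPDE.tao2011_nonlinearEstimate` (Tao 2011, §10, proof of Thm. 10.1,
estimate of `Y₆`, arXiv:1108.1165 pp. 32–33, in the annular geometry of Remark 10.6). We verify
the hypothesis of the abstract chain lemma `setIntegral_ball_sq_norm_le_of_chain`
(`FluidPDE/TaoY6WhitneyMass`) for the Lipschitz cutoff `η = annularRamp k a b |· − x₀|` of the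
annulus `Ω = {a < |x − x₀| < b}` (`0 < a`, `a + 2/k < b`): from a point `y ∈ Ω` at depth
`d ≤ 1/k` one walks radially towards the middle of the annulus (outwards near the inner sphere,
inwards near the outer sphere); the point at parameter `τ` has depth `τ` and the ball of radius
`τ/4` about it lies at depth `≥ 3τ/4`, where `η ≥ (3/4) k τ`. Consequently
(`setIntegral_ball_sq_norm_le_whitney`), for every `y ∈ Ω`, with `t = min(d(y), 1/k)`,

  `∫_{B(y, t/4)} ‖f‖² ≤ C_M (t/4) (k ∫‖f‖²η + k⁻¹ ∫‖Df‖²η)`,  `C_M = 2·10⁶`,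

for every `C¹` map `f` (the vorticity in the application): the local `L²` mass at the Whitney
scale is controlled by the localised enstrophy and the localised dissipation, with no logarithmic
loss (this is what Tao's estimate (10.23) plus the parent-ball chaining, p. 33, provide for the
discrete Whitney balls).

## References

* T. Tao, arXiv:1108.1165 (`Tao2011`), §10, proof of Thm. 10.1, pp. 32–33, and Remark 10.6.
-/

noncomputable section

open MeasureTheory Set Filter Metric Function
open scoped ENNReal NNReal

namespace Literature.Analysis.FluidPDE.TaoY6

variable {F : Type*} [NormedAddCommGroup F] [NormedSpace ℝ F] [CompleteSpace F]

section Radial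

variable {x₀ y : EuclideanSpace ℝ (Fin 3)}

/-- Moving along the radial ray: `|(y + s ρ⁻¹(y − x₀)) − x₀| = ρ + s` for `ρ = |y − x₀| > 0` and
`ρ + s ≥ 0`. [folklore] -/
theorem norm_add_smul_radial_sub (hy : y ≠ x₀) {s : ℝ} (hs : 0 ≤ ‖y - x₀‖ + s) :
    ‖y + s • (‖y - x₀‖⁻¹ • (y - x₀)) - x₀‖ = ‖y - x₀‖ + s := by
  have hρ : 0 < ‖y - x₀‖ := norm_pos_iff.2 (sub_ne_zero.2 hy)
  have h1 : y + s • (‖y - x₀‖⁻¹ • (y - x₀)) - x₀ = (1 + s * ‖y - x₀‖⁻¹) • (y - x₀) := by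
    rw [add_smul, one_smul, smul_smul]; abel
  rw [h1, norm_smul, Real.norm_eq_abs, abs_of_nonneg, add_mul, one_mul, mul_assoc,
    inv_mul_cancel₀ hρ.ne', mul_one]
  have : 0 ≤ (‖y - x₀‖ + s) * ‖y - x₀‖⁻¹ := mul_nonneg hs (inv_nonneg.2 hρ.le)
  calc (0 : ℝ) ≤ (‖y - x₀‖ + s) * ‖y - x₀‖⁻¹ := this
    _ = 1 + s * ‖y - x₀‖⁻¹ := by field_simp

/-- The radial unit vector has norm one. [folklore] -/
theorem norm_radial_unit (hy : y ≠ x₀) : ‖‖y - x₀‖⁻¹ • (y - x₀)‖ = 1 := by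
  have hρ : 0 < ‖y - x₀‖ := norm_pos_iff.2 (sub_ne_zero.2 hy)
  rw [norm_smul, norm_inv, norm_norm, inv_mul_cancel₀ hρ.ne']

end Radial

section Chain

variable {x₀ : EuclideanSpace ℝ (Fin 3)} {a b k : ℝ}

/-- The cutoff is bounded below by `(3/4) k τ` on a ball of radius `τ/4` whose points all have
depth at least `3τ/4` (`0 < τ ≤ 1/k`). [folklore] -/
theorem annularRamp_ge_of_annDepth_ge (hk : 0 < k) {τ : ℝ} (hτk : τ ≤ k⁻¹)
    {z : EuclideanSpace ℝ (Fin 3)} (hz : 3 / 4 * τ ≤ annDepth x₀ a b z) (hτ : 0 < τ) :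
    3 / 4 * (k * τ) ≤ annularRamp k a b ‖z - x₀‖ := by
  have h0 : 0 ≤ annDepth x₀ a b z := le_trans (by positivity) hz
  rw [annularRamp_norm_sub_eq_min hk.le h0, le_min_iff]
  constructor
  · have : k * τ ≤ 1 := by
      calc k * τ ≤ k * k⁻¹ := mul_le_mul_of_nonneg_left hτk hk.le
        _ = 1 := mul_inv_cancel₀ hk.ne'
    linarith
  · nlinarith

/-- **The chain hypothesis near the inner sphere.** Let `y ∈ Ω` lie in the inner layer
(`d = |y − x₀| − a ≤ 1/k`, `a > 0`, `a + 2/k < b`) and let `v = (y − x₀)/|y − x₀|`. Then for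
every `τ ∈ [d, 1/k]`, on the ball `B(y + (τ − d)v, τ/4)` (centred at depth `τ`) one has
`η ≥ (3/4) k τ`. [folklore] -/
theorem chain_hypothesis_inner (hk : 0 < k) (ha : 0 < a) (hab : a + 2 * k⁻¹ < b)
    {y : EuclideanSpace ℝ (Fin 3)} (hya : a < ‖y - x₀‖) :
    ∀ τ ∈ Icc (‖y - x₀‖ - a) k⁻¹,
      ∀ z ∈ ball (y + (τ - (‖y - x₀‖ - a)) • (‖y - x₀‖⁻¹ • (y - x₀))) (τ / 4),
        3 / 4 * (k * τ) ≤ annularRamp k a b ‖z - x₀‖ := by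
  intro τ hτ z hz
  have hy : y ≠ x₀ := fun h => by rw [h, sub_self, norm_zero] at hya; linarith
  have hτd : ‖y - x₀‖ - a ≤ τ := hτ.1
  have hτ0 : 0 < τ := lt_of_lt_of_le (sub_pos.2 hya) hτd
  -- the centre sits at distance `a + τ` from `x₀`
  have hc : ‖y + (τ - (‖y - x₀‖ - a)) • (‖y - x₀‖⁻¹ • (y - x₀)) - x₀‖ = a + τ := by
    rw [norm_add_smul_radial_sub hy (by linarith)]; ring
  -- hence `|z − x₀| ∈ (a + 3τ/4, a + 5τ/4)`
  rw [mem_ball, dist_eq_norm] at hz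
  have h1 : |‖z - x₀‖ - (a + τ)| < τ / 4 := by
    rw [← hc]
    refine lt_of_le_of_lt (abs_norm_sub_norm_le _ _) ?_
    rwa [sub_sub_sub_cancel_right]
  rw [abs_lt] at h1
  refine annularRamp_ge_of_annDepth_ge hk hτ.2 ?_ hτ0
  rw [annDepth_def, le_min_iff]
  constructor <;> linarith [hτ.2]

/-- **The chain hypothesis near the outer sphere.** Let `y ∈ Ω` lie in the outer layer
(`d = b − |y − x₀| ≤ 1/k`) and let `v = −(y − x₀)/|y − x₀|`. Then for every `τ ∈ [d, 1/k]`, on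
the ball `B(y + (τ − d)v, τ/4)` one has `η ≥ (3/4) k τ`. [folklore] -/
theorem chain_hypothesis_outer (hk : 0 < k) (ha : 0 < a) (hab : a + 2 * k⁻¹ < b)
    {y : EuclideanSpace ℝ (Fin 3)} (hya : a < ‖y - x₀‖) (hyb : ‖y - x₀‖ < b) :
    ∀ τ ∈ Icc (b - ‖y - x₀‖) k⁻¹,
      ∀ z ∈ ball (y + (τ - (b - ‖y - x₀‖)) • (-(‖y - x₀‖⁻¹ • (y - x₀)))) (τ / 4),
        3 / 4 * (k * τ) ≤ annularRamp k a b ‖z - x₀‖ := by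
  intro τ hτ z hz
  have hy : y ≠ x₀ := fun h => by rw [h, sub_self, norm_zero] at hya; linarith
  have hτd : b - ‖y - x₀‖ ≤ τ := hτ.1
  have hτ0 : 0 < τ := lt_of_lt_of_le (sub_pos.2 hyb) hτd
  have hkinv : 0 < k⁻¹ := inv_pos.2 hk
  -- the centre sits at distance `b − τ` from `x₀`
  have hc : ‖y + (τ - (b - ‖y - x₀‖)) • (-(‖y - x₀‖⁻¹ • (y - x₀))) - x₀‖ = b - τ := by
    rw [smul_neg, ← neg_smul, norm_add_smul_radial_sub hy (by linarith [hτ.2])]; ring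
  rw [mem_ball, dist_eq_norm] at hz
  have h1 : |‖z - x₀‖ - (b - τ)| < τ / 4 := by
    rw [← hc]
    refine lt_of_le_of_lt (abs_norm_sub_norm_le _ _) ?_
    rwa [sub_sub_sub_cancel_right]
  rw [abs_lt] at h1
  refine annularRamp_ge_of_annDepth_ge hk hτ.2 ?_ hτ0
  rw [annDepth_def, le_min_iff]
  constructor <;> linarith [hτ.2]

/-- **The Whitney-scale mass bound in the annulus** (Tao's (10.23) + parent-ball chaining, in the
form used here): for `0 < a`, `a + 2/k < b`, `η = annularRamp k a b |· − x₀|`, a `C¹` map `f` with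
`‖f‖²η`, `‖Df‖²η ∈ L¹`, and every `y ∈ Ω` with `t = min(d(y), 1/k)`:
`∫_{B(y, t/4)} ‖f‖² ≤ 2·10⁶ (t/4) (k ∫‖f‖²η + k⁻¹ ∫‖Df‖²η)`. [cite: Tao2011, §10, proof of Thm. 10.1 (pp. 32–33, (10.23) and the chaining) + Remark 10.6] -/
theorem setIntegral_ball_sq_norm_le_whitney {f : EuclideanSpace ℝ (Fin 3) → F} (hf : ContDiff ℝ 1 f)
    (hk : 0 < k) (ha : 0 < a) (hab : a + 2 * k⁻¹ < b) {y : EuclideanSpace ℝ (Fin 3)}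
    (hy : 0 < annDepth x₀ a b y)
    (hW : Integrable fun x => ‖f x‖ ^ 2 * annularRamp k a b ‖x - x₀‖)
    (hY : Integrable fun x => ‖fderiv ℝ f x‖ ^ 2 * annularRamp k a b ‖x - x₀‖) :
    ∫ x in ball y (min (annDepth x₀ a b y) k⁻¹ / 4), ‖f x‖ ^ 2 ≤
      2000000 * (min (annDepth x₀ a b y) k⁻¹ / 4) *
        (k * (∫ x, ‖f x‖ ^ 2 * annularRamp k a b ‖x - x₀‖) +
          k⁻¹ * ∫ x, ‖fderiv ℝ f x‖ ^ 2 * annularRamp k a b ‖x - x₀‖) := by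
  have hη0 : ∀ x : EuclideanSpace ℝ (Fin 3), 0 ≤ annularRamp k a b ‖x - x₀‖ := fun x =>
    annularRamp_nonneg _ _ _ _
  have hkinv : 0 < k⁻¹ := inv_pos.2 hk
  obtain ⟨hya, hyb⟩ := (annDepth_pos_iff y).1 hy
  have hyne : y ≠ x₀ := fun h => by rw [h, sub_self, norm_zero] at hya; linarith
  set W : ℝ := ∫ x, ‖f x‖ ^ 2 * annularRamp k a b ‖x - x₀‖ with hWdef
  set Y : ℝ := ∫ x, ‖fderiv ℝ f x‖ ^ 2 * annularRamp k a b ‖x - x₀‖ with hYdef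
  have hW0 : 0 ≤ W := integral_nonneg fun x => mul_nonneg (sq_nonneg _) (hη0 x)
  have hY0 : 0 ≤ Y := integral_nonneg fun x => mul_nonneg (sq_nonneg _) (hη0 x)
  rcases le_or_gt (annDepth x₀ a b y) k⁻¹ with hdk | hdk
  · -- the layer: chain
    rw [min_eq_left hdk]
    rw [annDepth_def] at hdk hy ⊢
    rcases le_total (‖y - x₀‖ - a) (b - ‖y - x₀‖) with hio | hio
    · -- inner layer
      rw [min_eq_left hio] at hdk ⊢
      exact setIntegral_ball_sq_norm_le_of_chain hf hη0 hk (sub_pos.2 hya) hdk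
        (norm_radial_unit hyne) (chain_hypothesis_inner hk ha hab hya) hW hY
    · -- outer layer
      rw [min_eq_right hio] at hdk ⊢
      have hv : ‖-(‖y - x₀‖⁻¹ • (y - x₀))‖ = 1 := by rw [norm_neg, norm_radial_unit hyne]
      exact setIntegral_ball_sq_norm_le_of_chain hf hη0 hk (sub_pos.2 hyb) hdk hv
        (chain_hypothesis_outer hk ha hab hya hyb) hW hY
  · -- the core: trivial bound `η ≥ 3/4` on the ball
    rw [min_eq_right hdk.le]
    have hηB : ∀ z ∈ ball y (k⁻¹ / 4), (3 / 4 : ℝ) ≤ annularRamp k a b ‖z - x₀‖ := by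
      intro z hz
      rw [mem_ball, dist_eq_norm] at hz
      have hdz : 3 / 4 * k⁻¹ ≤ annDepth x₀ a b z := by
        have h := abs_annDepth_sub_le x₀ a b z y
        rw [abs_le] at h
        linarith [h.1]
      have := annularRamp_ge_of_annDepth_ge (x₀ := x₀) (a := a) (b := b) hk le_rfl hdz hkinv
      rwa [mul_inv_cancel₀ hk.ne', mul_one] at this
    have hmass := setIntegral_le_inv_mul_integral_mul_of_le (fun x => sq_nonneg ‖f x‖) hη0
      measurableSet_ball (by norm_num : (0 : ℝ) < 3 / 4) hηB
      (integrableOn_of_continuous_of_isBounded (hf.continuous.norm.pow 2) isBounded_ball) hW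
    calc ∫ x in ball y (k⁻¹ / 4), ‖f x‖ ^ 2 ≤ (3 / 4 : ℝ)⁻¹ * W := hmass
      _ ≤ 2000000 * (k⁻¹ / 4) * (k * W + k⁻¹ * Y) := by
          have e : 2000000 * (k⁻¹ / 4) * (k * W + k⁻¹ * Y) = 500000 * W + 500000 * (k⁻¹ * k⁻¹ * Y) := by
            field_simp
            ring
          rw [e]
          nlinarith [mul_nonneg (mul_nonneg hkinv.le hkinv.le) hY0]

end Chain

end Literature.Analysis.FluidPDE.TaoY6

end
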